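import Summits.BirchSwinnertonDyer.BirchSwinnertonDyer.Theses.RamifiedHeegnerPair
import Summits.BirchSwinnertonDyer.BirchSwinnertonDyer.Theorems.RamifiedHeegnerPairGss2LowerAtThreeRankOneMcCallumRoad
import Summits.BirchSwinnertonDyer.BirchSwinnertonDyer.Theorems.RamifiedHeegnerPairKolyvaginStructureShapeOneClass
import Summits.BirchSwinnertonDyer.BirchSwinnertonDyer.Theorems.RamifiedHeegnerPairLeafOfRefinedKolyvagin
import HarnessLib

/-!
# Route `RamifiedHeegnerPair`, deciding crux L₁ `Gss2LowerAtThreeRankOne` (stmt-BirchSwinnertonDyer-26021) BY NAME — McCallum currency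
# (the line's v3 composition) and the citable structure SHAPE in place of the one-sided form (v2 road and joint capstone re-read)

HONEST FRAMING. Theorems only; helper file (`--supports stmt-BirchSwinnertonDyer-26021`); no definition, no named fact, no `sorry`;
nothing is booked, no item is closed, BSD is not proved for any curve; CONDITIONAL on every displayed input (audit `proof.conditional`).
Lead prover bsd-line-rhp-p1 g4, 2026-08-28. Companion of `…Gss2LowerAtThreeRankOneMcCallumRoad.lean` (p618012, §11–§13) and
`…KolyvaginStructureShapeOneClass.lean` (p618315, §14–§15); this file imports the route file (BY-NAME theorems only).

* §16 `gss2LowerAtThreeRankOne_of_exists_mccallumCertificate_of_nonTower` — THE v3 COMPOSITION of line `kolyvagin_split` (skeleton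
  102a5bdc6a638030): 26021 ⟸ `PublishedInputsAdditiveKoly` (item 20137: ten named facts) ∧ Kato 14.5(3)+14.16(2) ∧ [per tower row SOME
  split frame with SOME derived-POINT certificate of adjusted BSD depth] ∧ [L₁ on the non-tower rows]; and
  `gss2LowerAtThreeRankOne_of_certificates_of_nonTower` — the ∀-frame variant (k1-c3x Part 17d shape, Manin facts displayed).
* §17 `gssLowerAtThree_rankOne_towerRows_of_structureShape_of_rkc3Indivisibility` /
  `gss2LowerAtThreeRankOne_of_structureShape_of_rkc3Indivisibility_of_nonTower` — p612743 §9/§10 with the one-sided hypothesis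
  `AdditiveThree.OneClassLowerBoundShape` REPLACED by the citable two-sided SHAPE `AdditiveThree.KolyvaginStructureThreeShape` (§15).
* §18 `wAllExclAddGssAtThree_of_sigmaStar_of_rkc3Indivisibility_of_structureShape_of_lowerRankZero_of_nonTower` — the joint capstone
  p614585 (whole leaf ⟸ PUB★ ∧ Σ★ ∧ structure ∧ T1⁻ ∧ L₀ ∧ [L₁ non-tower]) re-read with the SHAPE.

NET (planner's reading, rev 7): on the 3-adic-tower rows the deciding member L₁ is, in the kernel, EITHER [eleven named Literature
facts] ∧ [one derived-point certificate of BSD depth per row, McCallum currency] (§16), OR [print] ∧ [the published structure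
theorem in its citable two-sided shape] ∧ [`AdditiveThree.RKC3Indivisibility`] (§17); the non-tower rows are displayed. No
Summits-side one-sided shape remains anywhere in the line. BSD is not proved; 26021 is OPEN.

References: [cite: McCallumLMS1991, §5 Lemma 5.1 (p. 303), Thm. 5.4 (p. 288), Cor. 5.6 (p. 310)] [cite: WZhang2014, Thm. 1.1, Thm. 10.2,
Remark 18] [cite: Jetchev2008, Conj. 1.3] [cite: JetchevSkinnerWan2017, §7.4.1 (pp. 29–31)] [cite: Kato2004Asterisque, Thm. 14.5 (3) (p. 236)]
[cite: MatarNekovar2019, Thm. 0.7] [cite: Mazur1978, Cor. 4.1] [cite: AbbesUllmo1996, Thm. A] [cite: Cesnavicius2018, Thm. 1.2]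
[cite: Miller2011LMS, Def. 1.1].
-/

-- D-0017: single-problem summit, so `Summit.BirchSwinnertonDyer.BirchSwinnertonDyer.…` repeats a namespace BY DESIGN.
set_option linter.dupNamespace false
set_option autoImplicit false

noncomputable section

open scoped Classical NumberField

open WeierstrassCurve Literature Literature.NumberTheory.EllipticCurves
  Literature.NumberTheory.EllipticCurves.ModularForms
  Literature.NumberTheory.EllipticCurves.Rank1Residual
  Literature.NumberTheory.EllipticCurves.Rank1Residual.Typed
  Summit.BirchSwinnertonDyer.Rank1Residual Summit.BirchSwinnertonDyer.Rank1Residual.Additive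
  Summit.BirchSwinnertonDyer.Rank1Residual.X11b Summit.BirchSwinnertonDyer.Rank1Residual.X11b.Three
  Summit.BirchSwinnertonDyer.BirchSwinnertonDyer.Theses.RamifiedHeegnerPair
  Summit.BirchSwinnertonDyer.BirchSwinnertonDyer.Theorems

namespace Summit.BirchSwinnertonDyer.BirchSwinnertonDyer.Theorems.RamifiedPairLowerBound

/-! ## §16 26021 BY NAME in McCallum's currency (the registered composition of skeleton v3) -/

/-- **26021 BY NAME ⟸ `PublishedInputsAdditiveKoly` ∧ Kato ∧ [∃ frame + derived-point certificate per tower row] ∧ [L₁ non-tower].**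
`hPub` = item 20137 of route `AdditiveKolyvaginRoad` (Gross–Zagier, Kolyvagin, Kolyvagin's bound, GZK, modularity, newforms,
Hoffstein–Luo, Shimura reciprocity at conductor 1, McCallum Cor. 5.6, Darmon Thm. 3.6); `hKatoT` = Kato 2004 Thm. 14.5 (3) + Prop.
14.16 (2) Tamagawa-exact; `hC` = the registered load-bearing stub `stub_existsMcCallumCertificate_towerRows` VERBATIM; `hNT` = the
registered residual stub. The split by the 3-adic image; p618012 §12 on the tower rows. Closes nothing; BSD is not proved.
[cite: McCallumLMS1991, §5 Cor. 5.6 (p. 310)] [cite: WZhang2014, Thm. 1.1 and Remark 5] [cite: Kato2004Asterisque, Thm. 14.5 (3) (p. 236)]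
[cite: Miller2011LMS, Def. 1.1] -/
theorem gss2LowerAtThreeRankOne_of_exists_mccallumCertificate_of_nonTower
    (hPub : Summit.BirchSwinnertonDyer.BirchSwinnertonDyer.Theses.AdditiveKolyvaginRoad.PublishedInputsAdditiveKoly)
    (hKatoT : Kato2004.rankZero_padicValNat_sha_add_padicValNat_tamagawa_le_of_additive_potGood_of_imageContainsSL2)
    (hC : ∀ (W : WeierstrassCurve ℚ) [W.IsElliptic] [W.IsGloballyMinimal],
      Addv W 3 → SubGss W 3 → W.analyticRank = 1 → (∀ n : ℕ, W.HasSurjectiveModNGaloisRep (3 ^ n : ℕ)) →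
      ∃ (N : ℕ) (_ : NeZero N) (K : Type) (_ : Field K) (_ : NumberField K)
        (Dt : ModularParametrizationData W N) (H : HeegnerDatum N (NumberField.discr K)) (ι : K →+* ℂ)
        (P : (W.baseChange K).toAffine.Point)
        (Wd : WeierstrassCurve ℚ) (_ : Wd.IsElliptic) (_ : Wd.IsGloballyMinimal) (Cd : VariableChange ℚ) (M : ℕ),
        W.conductorNorm ℤ = N ∧ IsImaginaryQuadratic K ∧ SatisfiesHeegnerHypothesis N K ∧
        (W.quadraticTwist (NumberField.discr K : ℚ)).entireLFunction 1 ≠ 0 ∧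
        WeierstrassCurve.Affine.Point.map ι.toRatAlgHom P = heegnerPointComplex Dt H ∧
        Cd • W.quadraticTwist (NumberField.discr K : ℚ) = Wd ∧
        (2 * M : ℤ) ≤ padicValNat 3 W.tamagawaProduct + padicValNat 3 Wd.tamagawaProduct +
          2 * padicValRat 3 (Dt.c : ℚ) ∧
        Three.Koly.CertificateAt Dt H.β ι 3 M)
    (hNT : ∀ (W : WeierstrassCurve ℚ) [W.IsElliptic] [W.IsGloballyMinimal],
      ¬ W.HasCM → Addv W 3 → SubGss W 3 → W.analyticRank = 1 →
      ¬ (∀ n : ℕ, W.HasSurjectiveModNGaloisRep (3 ^ n : ℕ)) → MissingLowerBoundAt W 3) :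
    Summit.BirchSwinnertonDyer.BirchSwinnertonDyer.Theses.RamifiedHeegnerPair.Gss2LowerAtThreeRankOne := by
  obtain ⟨hGZ, hKo, -, hGZK, hmod, -, -, hrec, hMc, h36⟩ := hPub
  intro W _ _ hCM hadd hsub hr
  by_cases hρ : ∀ n : ℕ, W.HasSurjectiveModNGaloisRep (3 ^ n : ℕ)
  · exact gssLowerAtThree_rankOne_towerRows_of_exists_mccallumCertificate hGZ hKo hKatoT hGZK hmod hrec h36 hMc hC W hadd
      hsub hr hρ
  · exact hNT W hCM hadd hsub hr hρ

/-- **26021 BY NAME, ∀-frame variant ⟸ `PublishedInputsAdditiveKoly` ∧ Kato ∧ Manin facts ∧ [BSD-depth certificates at every odd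
Manin-good Hoffstein–Luo frame of every tower row] ∧ [L₁ non-tower]** (p618012 §13 = k1-c3x Part 17d read on Gss2). Closes nothing.
[cite: McCallumLMS1991, §5 Cor. 5.6 (p. 310)] [cite: HoffsteinLuo1997, Theorem (§1)] [cite: Mazur1978, Cor. 4.1]
[cite: AbbesUllmo1996, Thm. A] [cite: Cesnavicius2018, Thm. 1.2] [cite: Miller2011LMS, Def. 1.1] -/
theorem gss2LowerAtThreeRankOne_of_certificates_of_nonTower
    (hPub : Summit.BirchSwinnertonDyer.BirchSwinnertonDyer.Theses.AdditiveKolyvaginRoad.PublishedInputsAdditiveKoly)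
    (hKatoT : Kato2004.rankZero_padicValNat_sha_add_padicValNat_tamagawa_le_of_additive_potGood_of_imageContainsSL2)
    (hMz : mazur_not_dvd_maninConstant_of_odd)
    (hAU : abbesUllmo_not_dvd_maninConstant_of_not_dvd_level)
    (hC2 : cesnavicius_not_two_dvd_maninConstant_of_two_dvd_level)
    (hCert : ∀ (W : WeierstrassCurve ℚ) [W.IsElliptic] [W.IsGloballyMinimal] [NeZero (W.conductorNorm ℤ)]
      (K : Type) [Field K] [NumberField K]
      (Dt : ModularParametrizationData W (W.conductorNorm ℤ)) (β : ℤ) (ι : K →+* ℂ),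
      Addv W 3 → SubGss W 3 → W.analyticRank = 1 → (∀ n : ℕ, W.HasSurjectiveModNGaloisRep (3 ^ n : ℕ)) →
      IsImaginaryQuadratic K → Odd (NumberField.discr K) →
      SatisfiesHeegnerHypothesis (W.conductorNorm ℤ) K →
      (W.quadraticTwist (NumberField.discr K : ℚ)).entireLFunction 1 ≠ 0 →
      (4 * (W.conductorNorm ℤ : ℤ)) ∣ β ^ 2 - NumberField.discr K → ¬ (3 : ℤ) ∣ Dt.c →
      ∃ M : ℕ, M ≤ padicValNat 3 W.tamagawaProduct ∧ Three.Koly.CertificateAt Dt β ι 3 M)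
    (hNT : ∀ (W : WeierstrassCurve ℚ) [W.IsElliptic] [W.IsGloballyMinimal],
      ¬ W.HasCM → Addv W 3 → SubGss W 3 → W.analyticRank = 1 →
      ¬ (∀ n : ℕ, W.HasSurjectiveModNGaloisRep (3 ^ n : ℕ)) → MissingLowerBoundAt W 3) :
    Summit.BirchSwinnertonDyer.BirchSwinnertonDyer.Theses.RamifiedHeegnerPair.Gss2LowerAtThreeRankOne := by
  intro W _ _ hCM hadd hsub hr
  by_cases hρ : ∀ n : ℕ, W.HasSurjectiveModNGaloisRep (3 ^ n : ℕ)
  · exact gssLowerAtThree_rankOne_towerRows_of_certificates hPub hKatoT hMz hAU hC2 hCert W hadd hsub hr hρ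
  · exact hNT W hCM hadd hsub hr hρ

/-! ## §17 The v2 road and 26021 BY NAME under the citable two-sided SHAPE of the structure theorem -/

/-- **L₁ on the tower rows ⟸ print ∧ `KolyvaginStructureThreeShape` ∧ `RKC3Indivisibility`** — p612743 §9 with its one-sided
structure hypothesis replaced by the citable SHAPE via §15 `oneClassLowerBoundShape_of_kolyvaginStructureThreeShape`.
[cite: McCallumLMS1991, Thm. 5.4 (p. 288) and Cor. 5.6 (p. 310)] [cite: WZhang2014, Thm. 1.1 and Remark 18] [cite: Jetchev2008, Conj. 1.3] -/
theorem gssLowerAtThree_rankOne_towerRows_of_structureShape_of_rkc3Indivisibility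
    (hGZ : ∀ (N : ℕ) [NeZero N] (W : WeierstrassCurve ℚ) (K : Type) [Field K] [NumberField K],
      gross_zagier N W K)
    (hKo : ∀ (N : ℕ) [NeZero N] (W : WeierstrassCurve ℚ) (K : Type) [Field K] [NumberField K],
      kolyvagin N W K)
    (hKatoT : Kato2004.rankZero_padicValNat_sha_add_padicValNat_tamagawa_le_of_additive_potGood_of_imageContainsSL2)
    (hGZK : rank_eq_analyticRank_of_analyticRank_le_one) (hmod : hasEntireLFunction_rat)
    (hnf : exists_isNewformOf) (hFH : friedbergHoffstein_exists_heegnerField_split_twist_ne_zero)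
    (hMz : mazur_not_dvd_maninConstant_of_odd)
    (hAU : abbesUllmo_not_dvd_maninConstant_of_not_dvd_level)
    (hC2 : cesnavicius_not_two_dvd_maninConstant_of_two_dvd_level)
    (hS : AdditiveThree.KolyvaginStructureThreeShape) (hT1 : AdditiveThree.RKC3Indivisibility) :
    ∀ (W : WeierstrassCurve ℚ) [W.IsElliptic] [W.IsGloballyMinimal],
      Addv W 3 → SubGss W 3 → W.analyticRank = 1 →
      (∀ n : ℕ, W.HasSurjectiveModNGaloisRep (3 ^ n : ℕ)) → MissingLowerBoundAt W 3 :=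
  gssLowerAtThree_rankOne_towerRows_of_structure_of_rkc3Indivisibility hGZ hKo hKatoT hGZK hmod hnf hFH hMz hAU hC2
    (oneClassLowerBoundShape_of_kolyvaginStructureThreeShape hS) hT1

/-- **26021 BY NAME ⟸ print ∧ `KolyvaginStructureThreeShape` ∧ `RKC3Indivisibility` ∧ [L₁ on the non-tower rows]** (p612743 §10
re-read with the SHAPE). Closes nothing; BSD is not proved by this. [cite: McCallumLMS1991, Thm. 5.4 (p. 288) and Cor. 5.6 (p. 310)]
[cite: WZhang2014, Thm. 1.1 and Remark 18] [cite: Miller2011LMS, Def. 1.1] -/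
theorem gss2LowerAtThreeRankOne_of_structureShape_of_rkc3Indivisibility_of_nonTower
    (hGZ : ∀ (N : ℕ) [NeZero N] (W : WeierstrassCurve ℚ) (K : Type) [Field K] [NumberField K],
      gross_zagier N W K)
    (hKo : ∀ (N : ℕ) [NeZero N] (W : WeierstrassCurve ℚ) (K : Type) [Field K] [NumberField K],
      kolyvagin N W K)
    (hKatoT : Kato2004.rankZero_padicValNat_sha_add_padicValNat_tamagawa_le_of_additive_potGood_of_imageContainsSL2)
    (hGZK : rank_eq_analyticRank_of_analyticRank_le_one) (hmod : hasEntireLFunction_rat)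
    (hnf : exists_isNewformOf) (hFH : friedbergHoffstein_exists_heegnerField_split_twist_ne_zero)
    (hMz : mazur_not_dvd_maninConstant_of_odd)
    (hAU : abbesUllmo_not_dvd_maninConstant_of_not_dvd_level)
    (hC2 : cesnavicius_not_two_dvd_maninConstant_of_two_dvd_level)
    (hS : AdditiveThree.KolyvaginStructureThreeShape) (hT1 : AdditiveThree.RKC3Indivisibility)
    (hNT : ∀ (W : WeierstrassCurve ℚ) [W.IsElliptic] [W.IsGloballyMinimal],
      ¬ W.HasCM → Addv W 3 → SubGss W 3 → W.analyticRank = 1 →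
      ¬ (∀ n : ℕ, W.HasSurjectiveModNGaloisRep (3 ^ n : ℕ)) → MissingLowerBoundAt W 3) :
    Summit.BirchSwinnertonDyer.BirchSwinnertonDyer.Theses.RamifiedHeegnerPair.Gss2LowerAtThreeRankOne :=
  gss2LowerAtThreeRankOne_of_structure_of_rkc3Indivisibility_of_nonTower hGZ hKo hKatoT hGZK hmod hnf hFH hMz hAU hC2
    (oneClassLowerBoundShape_of_kolyvaginStructureThreeShape hS) hT1 hNT

/-! ## §18 The joint capstone under the citable SHAPE -/

/-- **The W-ALL leaf Gss2 at `3` ⟸ PRINT ∧ Σ★ ∧ `KolyvaginStructureThreeShape` ∧ `RKC3Indivisibility` ∧ L₀ ∧ [L₁ non-tower]** — the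
joint capstone p614585 (rhp-p2 g3's p613148 ∘ rhp-p1 g3's p612743) with the one-sided structure hypothesis replaced by the citable
two-sided SHAPE (§15). CONDITIONAL (conditional-result); credits nothing; BSD is not proved. [cite: McCallumLMS1991, Thm. 5.4 (p. 288)]
[cite: Jetchev2008, Conj. 1.3 (p. 812)] [cite: WZhang2014, Thm. 1.1 and Remark 18] [cite: MatarNekovar2019, Thm. 0.7 (p. 456)]
[cite: Kato2004Asterisque, Thm. 14.5 (3) (p. 236)] [cite: Miller2011LMS, §1 and Def. 1.1] -/
theorem wAllExclAddGssAtThree_of_sigmaStar_of_rkc3Indivisibility_of_structureShape_of_lowerRankZero_of_nonTower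
    (hpubU : (∀ (N : ℕ) [NeZero N] (W : WeierstrassCurve ℚ) (K : Type) [Field K] [NumberField K], gross_zagier N W K) ∧
      (∀ (N : ℕ) [NeZero N] (W : WeierstrassCurve ℚ) (K : Type) [Field K] [NumberField K], kolyvagin N W K) ∧
      rank_eq_analyticRank_of_analyticRank_le_one ∧ WeierstrassCurve.hasEntireLFunction_rat ∧ GrossZagier1986_thm_I_7_3 ∧
      MatarNekovar2019.thm07_padicValNat_card_sha_primary_add_le_of_globalDivisibility_of_irreducible ∧ exists_isNewformOf ∧
      friedbergHoffstein_exists_heegnerField_splitDivisors_twist_ne_zero ∧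
      bumpFriedbergHoffstein_exists_heegnerField_split_twist_simpleZero ∧ nonempty_modularParametrizationData)
    (hKatoT : Kato2004.rankZero_padicValNat_sha_add_padicValNat_tamagawa_le_of_additive_potGood_of_imageContainsSL2)
    (hFH : friedbergHoffstein_exists_heegnerField_split_twist_ne_zero)
    (hMz : mazur_not_dvd_maninConstant_of_odd)
    (hAU : abbesUllmo_not_dvd_maninConstant_of_not_dvd_level)
    (hC2 : cesnavicius_not_two_dvd_maninConstant_of_two_dvd_level)
    (hStar : ∀ (W : WeierstrassCurve ℚ) [W.IsElliptic] [W.IsGloballyMinimal] (N : ℕ) [NeZero N]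
      (K : Type) [Field K] [NumberField K] (Dt : ModularParametrizationData W N)
      (H : HeegnerDatum N (NumberField.discr K)) (ι : K →+* ℂ) (P : (W.baseChange K).toAffine.Point),
      ¬ W.HasCM → Addv W 3 → SubGss W 3 → W.conductorNorm ℤ = N → IsImaginaryQuadratic K →
      SatisfiesHeegnerHypothesis N K →
      (WeierstrassCurve.Affine.Point.map ι.toRatAlgHom) P = heegnerPointComplex Dt H → ¬ IsOfFinAddOrder P →
      Odd (NumberField.discr K) →
      ∀ (s' : ℕ), s' ≤ padicValNat 3 W.tamagawaProduct + padicValNat 3 Dt.c.natAbs →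
      ∀ (n : ℕ) (d : KolyvaginHeegnerData Dt H.β ι n), Squarefree n →
      (∀ ℓ ∈ n.primeFactors, Zhang2014.IsKolyvaginPrime N W K 3 ℓ ∧ s' ≤ Zhang2014.kolyvaginIndex W 3 ℓ) → Koly.PDiv d 3 s')
    (hS : AdditiveThree.KolyvaginStructureThreeShape) (hT1 : AdditiveThree.RKC3Indivisibility)
    (hL0 : Gss2LowerAtThreeRankZero)
    (hNT : ∀ (W : WeierstrassCurve ℚ) [W.IsElliptic] [W.IsGloballyMinimal],
      ¬ W.HasCM → Addv W 3 → SubGss W 3 → W.analyticRank = 1 →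
      ¬ (∀ n : ℕ, W.HasSurjectiveModNGaloisRep (3 ^ n : ℕ)) → MissingLowerBoundAt W 3) :
    Summit.BirchSwinnertonDyer.WAllExclAddGssAtThree :=
  wAllExclAddGssAtThree_of_sigmaStar_of_rkc3Indivisibility_of_structure_of_lowerRankZero_of_nonTower hpubU hKatoT hFH hMz hAU hC2
    hStar (oneClassLowerBoundShape_of_kolyvaginStructureThreeShape hS) hT1 hL0 hNT

end Summit.BirchSwinnertonDyer.BirchSwinnertonDyer.Theorems.RamifiedPairLowerBound

end
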